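import Summits.QuantumFields.BalabanUV.T4Continuum.Support.NE7CriticalSliceAdapter
import Summits.QuantumFields.BalabanUV.T4Continuum.Support.NE3ClassRadiusFamily
import HarnessLib

/-!
# NE7ConvOneStepLines — (P♮)_W DISCHARGED BY NAME: ONE-STEP from «CRIT-ONE-STEP on `ker levelQ'` + REP» and row NE3's FOUR k-FREE NUMERIC LINES,
# with NO Poincaré hypothesis left (row NE3-R2's `NE3ClassSlicePoincare.classSlicePoincare_of_lines` plugged into F10)

Cell `pub-balaban`, rung (B)+1 sub-cell t4, lineage `b2b-balaban-t4-ne7-p1`, generation 66 (CRUX PROVER NE7 #1); hunt (h10) «ONE-STEP = CRIT ∧ CONV»,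
memo `t4/b2b-balaban-t4-ne7-p1-g66/HUNT-H10-TWO-ROADS.md` §2.  File F11 (over F10 `NE7CriticalSliceAdapter` p351593 and [tree] `NE3ClassRadiusFamily` ∕
`NE3ClassSlicePoincare`).

WHAT ([folklore] composition; 0 def, 0 sorry).  **`oneStep_of_kerCritical_rep_lines`** — for `3 ≤ d`, `2 ≤ L`, `1 ≤ N`, class radius `0 < ε ≤ θ`,
K1 cut `0 < εc`, row Y9's level family `∀ k, LevelSmall d L k (ε(L^{k+1})^{−2})` and the FOUR k-free numeric lines of
`NE3ClassSlicePoincare.classSlicePoincare_of_lines` (`ShLine ≤ 1∕2`, `SmallYLine ≤ 1∕2`, the `C2sq`∕`rho` line, the `θ²` line; at `d = 4`, `L = 2`,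
SU(2)∕SU(3) they carry no hypothesis but `ε ≤ 10⁻⁵³`, row NE3's §4 numerics): the ONE-STEP binder of `NE7InteriorInduction.interior_exists_all_levels` (hence
(8)∃, hence route 1's (A)-bill) follows from «for every admissible competitor `U₀` of level `k+1` with `SmallField U₀ (δ(L^k)^{−2})` there is an
admissible `U♯` with `SmallField U♯ (δ(L^{k+1})^{−2})`, CRITICAL ON `ker (levelQ' L N k U♯)` (equivalently — F8 — solving the Euler–Lagrange system with
a coarse multiplier), over which every admissible `U′` is REPRESENTED (gauge-fixed `X` with `X_T ∈ T_♮(U♯)` and the two normal letters `θ_N`, `C_N`)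
under the numeric line of F4 with the constant `CP := CPLine d L (card n) εc θ + 1`».  So after this file ONE-STEP's residual is LITERALLY
CRIT-ONE-STEP ∧ REP ∧ numeric lines — (P♮)_W is no longer a hypothesis of the NE7 side.
HONEST FRAMING (page 1): composition over HYPOTHESES (CRIT, REP, numeric lines); nothing of Bałaban's minimisers asserted; NOT ONE-STEP, NOT NE7; spine
0∕9; finite T⁴ rung (B)+1 — NOT infinite volume, NOT mass gap, NOT Clay.  Continuum YM on T⁴ ⇐ BetaPertH ∧ nine spine estimates (0/9 proved); BetaPertH
⇐ (D1) ∧ (D4) ∧ CAP+tail; G-an2-4 gates asym, D1 and NE2/3/4.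
-/

set_option autoImplicit false

open scoped BigOperators Matrix.Norms.L2Operator
open NormedSpace Finset Set

namespace Summit.QuantumFields.BalabanUV.T4Continuum.NE7ConvOneStepLines

open Literature.MathematicalPhysics.QuantumFieldTheory.Balaban1983to89
open B7Prop1Explicit B7Prop2Explicit MatrixLog UnitaryModel
open T4AveragingDeficitWall (IsUnitaryCfg IsSkewDir SmallField fineAction vary curl curlSq dirSq)
open T4AveragingDeficitWallBoundary (IsPeriodicCfg periodBox)
open AveragingDeficitPeriodicCounting (IsPeriodicDir)
open AveragingDeficitTorusChart (TDir extDir)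
open AveragingDeficitMultiLevelPrep (tower LevelSmall levelQ')
open MinimalActionLevels (levelAction perWin)
open MinimalActionSandwich (IsMinimiser admissible)
open MinimalActionRate (sfClass)
open NE3HessForm (dAction)
open NE3SlicePoincareShape (SlicePoincare slicePoincare_mono)
open NE3FrameFreeSliceW (frameFreeBlockLandauW)
open NE3CovariantLineSumsL2 (C2sq)
open NE3CovariantLineSumsL2Tower (rho)
open NE3SlicePoincareBudgetLine (ShLine SmallYLine CPLine)
open NE3ClassSlicePoincare (classSlicePoincare_of_lines)
open NE3ClassRadiusFamily (CPLine_nonneg)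
open NE7CriticalSliceAdapter (oneStep_of_kerCritical_rep_class)

noncomputable section

variable {d : ℕ} {n : Type*} [Fintype n] [DecidableEq n]

/-- **ONE-STEP FROM CRIT-ONE-STEP ON `ker levelQ'` + REP + ROW NE3's FOUR NUMERIC LINES** (no Poincaré hypothesis; constant
`CP = CPLine d L (card n) εc θ + 1`).  See the module docstring. [folklore] -/
theorem oneStep_of_kerCritical_rep_lines [Nonempty n] (hd : 3 ≤ d) {L N : ℕ} [NeZero L] [NeZero N] (hL : 2 ≤ L) (hN : 1 ≤ N)
    {ε θ εc δ : ℝ} (hε : 0 < ε) (hεθ : ε ≤ θ) (hεc : 0 < εc)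
    (hls : ∀ k : ℕ, LevelSmall d L k (ε / ((L : ℝ) ^ (k + 1)) ^ 2))
    (h1 : ShLine d L (Fintype.card n) εc θ ≤ 1 / 2) (h2 : SmallYLine d L (Fintype.card n) εc θ ≤ 1 / 2)
    (h3 : 68 / 3 * (((d : ℝ) + 1) * ((d : ℝ) + 4)) * C2sq d L * θ ≤ rho d L / 2)
    (h4 : 8 * d * (((d : ℝ) - 1) * θ) ^ 2
      + 2 * ((Fintype.card n : ℝ) * ((4 * (d : ℝ) ^ 2 + 272 * d * (((d : ℝ) + 1) * ((d : ℝ) + 4))) * θ) ^ 2) ≤ 1 / 2)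
    {V : Site d → Fin d → (Matrix n n ℂ)ˣ}
    (hcrit : ∀ (k : ℕ) (U₀ : Site d → Fin d → (Matrix n n ℂ)ˣ), U₀ ∈ admissible (sfClass d L N ε) L (k + 1) V →
      SmallField U₀ (δ / ((L : ℝ) ^ k) ^ 2) →
      ∃ Us : Site d → Fin d → (Matrix n n ℂ)ˣ, Us ∈ admissible (sfClass d L N ε) L (k + 1) V ∧ SmallField Us (δ / ((L : ℝ) ^ (k + 1)) ^ 2) ∧
        (∀ Φ : TDir d n (L * tower L N k), (∀ r κ, Φ r κ ∈ skewAdjoint (Matrix n n ℂ)) →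
          levelQ' L N k Us Φ = 0 → dAction Us (extDir (L * tower L N k) Φ) (perWin d (N * L ^ (k + 1))) = 0) ∧
        ∀ U' ∈ admissible (sfClass d L N ε) L (k + 1) V, ∃ (X XT XN : Site d → Fin d → Matrix n n ℂ) (α θN CN : ℝ),
          IsSkewDir X ∧ IsPeriodicDir X ((N * L ^ (k + 1) : ℕ) : ℤ) ∧ 0 ≤ α ∧ (∀ x μ, ‖X x μ‖ ≤ α) ∧
          levelAction d L N (k + 1) (vary Us X 1) ≤ levelAction d L N (k + 1) U' ∧
          SmallField (vary Us X 1) (ε / ((L : ℝ) ^ (k + 1)) ^ 2) ∧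
          X = XT + XN ∧ XT ∈ frameFreeBlockLandauW (d := d) (n := n) L N (k + 1) Us ∧ IsSkewDir XN ∧
          IsPeriodicDir XN ((N * L ^ (k + 1) : ℕ) : ℤ) ∧
          dirSq XN (periodBox (d := d) (N * L ^ (k + 1))) ≤ θN * dirSq X (periodBox (d := d) (N * L ^ (k + 1))) ∧
          (∑ p ∈ perWin d (N * L ^ (k + 1)), ‖curl Us XN p‖) ≤ CN * dirSq X (periodBox (d := d) (N * L ^ (k + 1))) ∧
          2 * (ε / ((L : ℝ) ^ (k + 1)) ^ 2 * CN)
            ≤ (((((((L : ℝ) ^ (k + 1))⁻¹) ^ 2 / (CPLine d L (Fintype.card n) εc θ + 1)) / 4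
                - (((((L : ℝ) ^ (k + 1))⁻¹) ^ 2 / (CPLine d L (Fintype.card n) εc θ + 1)) / 2 + 16 * d) * θN) / 2
                - 576 * d * (Real.exp α - 1) ^ 2) / (Fintype.card n : ℝ) - 28 * d * (ε / ((L : ℝ) ^ (k + 1)) ^ 2 + 7 * α ^ 2))) :
    ∀ (k : ℕ) (U₀ : Site d → Fin d → (Matrix n n ℂ)ˣ), U₀ ∈ admissible (sfClass d L N ε) L (k + 1) V →
      SmallField U₀ (δ / ((L : ℝ) ^ k) ^ 2) →
      ∃ U, IsMinimiser d (sfClass d L N ε) L N (k + 1) V U ∧ SmallField U (δ / ((L : ℝ) ^ (k + 1)) ^ 2) := by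
  have hL1 : 1 ≤ L := by omega
  have hd1 : 1 ≤ d := by omega
  -- row Y9's family at the levels `j+1`
  have hsmall : ∀ j : ℕ, LevelSmall d L (j + 1) (ε / ((L : ℝ) ^ (j + 2)) ^ 2) := fun j => by
    simpa [show j + 1 + 1 = j + 2 from rfl] using hls (j + 1)
  -- (P♮)_W at class level with the k-free constant `CPLine`, lifted to `CPLine + 1 > 0`
  have hP0 := classSlicePoincare_of_lines (n := n) hd hL hN hε hεθ hεc hsmall h1 h2 h3 h4
  have hCP0 : 0 ≤ CPLine d L (Fintype.card n) εc θ :=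
    CPLine_nonneg hd1 (Nat.cast_nonneg _) hεc.le (hε.le.trans hεθ)
  have hCP : 0 < CPLine d L (Fintype.card n) εc θ + 1 := by linarith
  have hP : ∀ (j : ℕ) (W : Site d → Fin d → (Matrix n n ℂ)ˣ), W ∈ sfClass d L N ε (j + 1) →
      SlicePoincare L (j + 1) W (frameFreeBlockLandauW L N (j + 1) W) (CPLine d L (Fintype.card n) εc θ + 1)
        (periodBox (d := d) (N * L ^ (j + 1))) :=
    fun j W hW => slicePoincare_mono (hP0 j W hW) (by linarith)
  exact oneStep_of_kerCritical_rep_class hL1 hN hε.le hCP hls hP hcrit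

end

end Summit.QuantumFields.BalabanUV.T4Continuum.NE7ConvOneStepLines
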